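import Literature.Probability.RandomPlanarGeometry.RestrictionHullsProofs
import HarnessLib

/-!
# Julia's lemma in the upper half-plane (boundary Schwarz–Pick at `∞` and at `0`)

Ch. Pommerenke, *Boundary Behaviour of Conformal Maps*, Springer (1992), §4.3, **Prop. 4.13**
(the Julia–Wolff lemma: for an analytic self-map `φ` of `𝔻` with angular limit `φ(ζ) ∈ 𝕋` at
`ζ ∈ 𝕋`, the angular derivative exists and
`0 < ζ φ'(ζ)/φ(ζ) = sup_z (1 - |z|²)/|ζ - z|² · |φ(ζ) - φ(z)|²/(1 - |φ(z)|²) ≤ +∞`, i.e.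
horodiscs at `ζ` are mapped into horodiscs at `φ(ζ)` scaled by the angular derivative),
transported to `ℍₒ = {im > 0}` with the boundary points `∞` and `0`, in the elementary form that
follows from the two-point Schwarz–Pick inequality of the tree
(`Literature.Probability.RandomPlanarGeometry.HalfPlanePick.norm_sub_sq_mul_le`, `RestrictionHullsProofs`) by a limit along the
imaginary axis. For a holomorphic self-map `F` of `ℍₒ`:

* `Literature.Probability.RandomPlanarGeometry.HalfPlanePick.im_le_im_of_tendsto_div` — if `F(iy)/(iy) → 1` as `y → +∞` then
  `im w ≤ im F(w)` (the horodiscs `{im w > h}` at `∞` are mapped into themselves); the tree's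
  `IsRestrictionMap.im_le_im` (`RestrictionHullsProofs`) is the case `F = Φ_A⁻¹`, and
  `Complex.im_le_im_of_tendsto_sub_self` (`Literature.Analysis.Complex.HalfPlaneRigidity`) the
  case of the stronger normalisation `F(z) - z → 0`;
* `Literature.Probability.RandomPlanarGeometry.HalfPlanePick.im_div_le_of_tendsto_div` — if `F(iy)/(iy) → λ > 0` as `y → 0⁺` then
  `im w/|w|² ≤ λ im F(w)/|F(w)|²` (horodiscs at `0`), by conjugation with `ζ ↦ -1/ζ`;
* `Literature.Probability.RandomPlanarGeometry.HalfPlanePick.one_le_of_tendsto_div` — both normalisations together force `λ ≥ 1`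
  (the angular derivatives at two boundary fixed points multiply to at least `1`), the
  inequality behind the monotonicity `Φ'_A(0) ≤ Φ'_{A'}(0)` for `*`-hulls `A' ⊆ A`
  (Pommerenke (1992), Thm. 4.14; in the tree `HasRestrictionDeriv.le_of_subset`).

Everything here is proved. Mathlib has no Julia / Julia–Wolff lemma (searched `Julia`,
`angular derivative`, `horodisc`).

## References

* Ch. Pommerenke, *Boundary Behaviour of Conformal Maps*, Grundlehren 299, Springer (1992),
  §4.3 (pp. 79–84), Prop. 4.13 and Thm. 4.14.
* L. V. Ahlfors, *Complex Analysis*, 3rd ed. (1979), Ch. 4 §3.4 (the lemma of Schwarz and its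
  invariant form).
-/

noncomputable section

open Set Filter Topology Metric Complex
open UpperHalfPlane (upperHalfPlaneSet isOpen_upperHalfPlaneSet)

namespace Literature.Probability.RandomPlanarGeometry

namespace HalfPlanePick

/-! ### Julia's lemma in the half-plane, at `∞` and at `0` -/

/-- The points `i y`, `y → +∞`, eventually lie in `ℍₒ` with `0 < y`. [folklore] -/
theorem eventually_I_mul_mem_atTop :
    ∀ᶠ y : ℝ in atTop, (I * (y : ℂ)) ∈ upperHalfPlaneSet ∧ 0 < y := by
  filter_upwards [eventually_gt_atTop 0] with y hy
  exact ⟨show 0 < (I * (y : ℂ)).im by simpa using hy, hy⟩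

/-- **Julia's lemma at `∞`** (boundary Schwarz–Pick lemma; Pommerenke (1992), §4.3,
Prop. 4.13, transported to `ℍₒ` with the boundary point at `∞`): a holomorphic self-map `F` of
`ℍₒ` with `F(iy)/(iy) → 1` as `y → +∞` satisfies `im w ≤ im F(w)` on `ℍₒ`. Proof: the two-point
Schwarz–Pick inequality at the pair `(w, iy)`, divided by `y³`, in the limit `y → ∞`.
[cite: PommerenkeBBCM1992, §4.3 Prop. 4.13] -/
theorem im_le_im_of_tendsto_div {F : ℂ → ℂ} (hd : DifferentiableOn ℂ F upperHalfPlaneSet)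
    (hmaps : MapsTo F upperHalfPlaneSet upperHalfPlaneSet)
    (hlim : Tendsto (fun y : ℝ ↦ F (I * y) / (I * y)) atTop (𝓝 1)) {w : ℂ} (hw : 0 < w.im) :
    w.im ≤ (F w).im := by
  set u : ℝ → ℂ := fun y ↦ F (I * y) / (I * y) with hu
  -- the Schwarz–Pick inequality at `(w, iy)`, divided by `y³`
  have hineq : ∀ᶠ y : ℝ in atTop,
      ‖F w / y - I * u y‖ ^ 2 * w.im ≤ ‖w / y - I‖ ^ 2 * ((F w).im * (u y).re) := by
    filter_upwards [eventually_I_mul_mem_atTop] with y ⟨hyΩ, hy⟩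
    have hSP := norm_sub_sq_mul_le hd hmaps hw (show 0 < (I * (y : ℂ)).im from hyΩ)
    have hIy : (I * (y : ℂ)).im = y := by simp
    rw [hIy] at hSP
    have hy0 : (y : ℂ) ≠ 0 := ofReal_ne_zero.2 hy.ne'
    have hFIy : F (I * y) = I * y * u y := by
      rw [hu]
      field_simp
    have him : (F (I * y)).im = y * (u y).re := by
      rw [hFIy]
      simp
    have hny : ‖(y : ℂ)‖ = y := by rw [norm_real, Real.norm_eq_abs, abs_of_pos hy]
    have h1 : ‖w - I * y‖ = y * ‖w / y - I‖ := by
      have : w - I * y = y * (w / y - I) := by field_simp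
      rw [this, norm_mul, hny]
    have h2 : ‖F w - F (I * y)‖ = y * ‖F w / y - I * u y‖ := by
      have : F w - F (I * y) = y * (F w / y - I * u y) := by
        rw [hFIy]
        field_simp
      rw [this, norm_mul, hny]
    rw [h1, h2, him] at hSP
    have key : y ^ 3 * (‖F w / y - I * u y‖ ^ 2 * w.im) ≤
        y ^ 3 * (‖w / y - I‖ ^ 2 * ((F w).im * (u y).re)) := by
      convert hSP using 1 <;> ring
    exact le_of_mul_le_mul_left key (by positivity)
  -- pass to the limit `y → ∞`
  have hy_inv : Tendsto (fun y : ℝ ↦ (y : ℂ)⁻¹) atTop (𝓝 0) := by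
    simpa using tendsto_inv_atTop_zero.ofReal
  have hwy : Tendsto (fun y : ℝ ↦ w / y) atTop (𝓝 0) := by
    simpa [div_eq_mul_inv] using hy_inv.const_mul w
  have hFwy : Tendsto (fun y : ℝ ↦ F w / y) atTop (𝓝 0) := by
    simpa [div_eq_mul_inv] using hy_inv.const_mul (F w)
  have hL : Tendsto (fun y : ℝ ↦ ‖F w / y - I * u y‖ ^ 2 * w.im) atTop
      (𝓝 (‖(0 : ℂ) - I * 1‖ ^ 2 * w.im)) :=
    ((hFwy.sub (hlim.const_mul I)).norm.pow 2).mul_const _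
  have hR : Tendsto (fun y : ℝ ↦ ‖w / y - I‖ ^ 2 * ((F w).im * (u y).re)) atTop
      (𝓝 (‖(0 : ℂ) - I‖ ^ 2 * ((F w).im * (1 : ℂ).re))) :=
    ((hwy.sub_const I).norm.pow 2).mul
      (tendsto_const_nhds.mul ((continuous_re.tendsto 1).comp hlim))
  have := le_of_tendsto_of_tendsto hL hR hineq
  simpa using this

/-- `-ζ⁻¹ ∈ ℍₒ` for `ζ ∈ ℍₒ`, with `im (-ζ⁻¹) = im ζ / ‖ζ‖²`. [folklore] -/
theorem neg_inv_im (ζ : ℂ) : (-ζ⁻¹).im = ζ.im / ‖ζ‖ ^ 2 := by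
  rw [neg_im, inv_im, neg_div, neg_neg, normSq_eq_norm_sq]

/-- `-ζ⁻¹ ∈ ℍₒ` for `ζ ∈ ℍₒ`. [folklore] -/
theorem neg_inv_mem {ζ : ℂ} (hζ : 0 < ζ.im) : 0 < (-ζ⁻¹).im := by
  rw [neg_inv_im]
  have hζ0 : ζ ≠ 0 := by
    rintro rfl
    simp at hζ
  positivity

/-- **Julia's lemma at the boundary point `0`** (Pommerenke (1992), §4.3, Prop. 4.13, in `ℍₒ`):
a holomorphic self-map `F` of `ℍₒ` with `F(iy)/(iy) → λ > 0` as `y → 0⁺` maps the horodiscs at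
`0` into horodiscs scaled by `λ`: `im w / ‖w‖² ≤ λ · im F(w) / ‖F w‖²`. Proof: Julia's lemma at
`∞` for `ζ ↦ -λ / F(-1/ζ)`. [cite: PommerenkeBBCM1992, §4.3 Prop. 4.13] -/
theorem im_div_le_of_tendsto_div {F : ℂ → ℂ} (hd : DifferentiableOn ℂ F upperHalfPlaneSet)
    (hmaps : MapsTo F upperHalfPlaneSet upperHalfPlaneSet) {c : ℝ} (hc : 0 < c)
    (hlim : Tendsto (fun y : ℝ ↦ F (I * y) / (I * y)) (𝓝[>] 0) (𝓝 (c : ℂ))) {w : ℂ}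
    (hw : 0 < w.im) :
    w.im / ‖w‖ ^ 2 ≤ c * (F w).im / ‖F w‖ ^ 2 := by
  -- the conjugated self-map `G ζ = -c / F (-ζ⁻¹)`
  set G : ℂ → ℂ := fun ζ ↦ -(c : ℂ) / F (-ζ⁻¹) with hG
  have hneg : MapsTo (fun ζ : ℂ ↦ -ζ⁻¹) upperHalfPlaneSet upperHalfPlaneSet :=
    fun ζ hζ ↦ neg_inv_mem hζ
  have hneg_d : DifferentiableOn ℂ (fun ζ : ℂ ↦ -ζ⁻¹) upperHalfPlaneSet := by
    refine DifferentiableOn.neg (differentiableOn_inv.mono ?_)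
    intro ζ hζ hζ0
    have : (0 : ℝ) < (ζ : ℂ).im := hζ
    rw [show ζ = 0 from hζ0] at this
    simp at this
  have hF_ne : ∀ ζ ∈ upperHalfPlaneSet, F (-ζ⁻¹) ≠ 0 := by
    intro ζ hζ h0
    have : (0 : ℝ) < (F (-ζ⁻¹)).im := hmaps (hneg hζ)
    rw [h0] at this
    simp at this
  have hGd : DifferentiableOn ℂ G upperHalfPlaneSet := by
    refine DifferentiableOn.div (differentiableOn_const _) (hd.comp hneg_d hneg) hF_ne
  have hGim : ∀ ζ : ℂ, (G ζ).im = c * (F (-ζ⁻¹)).im / ‖F (-ζ⁻¹)‖ ^ 2 := by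
    intro ζ
    rw [hG]
    simp only [div_eq_mul_inv, neg_mul, neg_im, mul_im, ofReal_re, ofReal_im, zero_mul,
      add_zero, inv_im, normSq_eq_norm_sq]
    ring
  have hGmaps : MapsTo G upperHalfPlaneSet upperHalfPlaneSet := by
    intro ζ hζ
    show 0 < (G ζ).im
    rw [hGim]
    have h1 : 0 < (F (-ζ⁻¹)).im := hmaps (hneg hζ)
    have h2 : 0 < ‖F (-ζ⁻¹)‖ := norm_pos_iff.2 (hF_ne ζ hζ)
    positivity
  -- its normalisation at `∞`
  have hGlim : Tendsto (fun y : ℝ ↦ G (I * y) / (I * y)) atTop (𝓝 1) := by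
    have h1 : Tendsto (fun y : ℝ ↦ F (I * ↑(y⁻¹)) / (I * ↑(y⁻¹))) atTop (𝓝 (c : ℂ)) :=
      hlim.comp tendsto_inv_atTop_nhdsGT_zero
    have hc0 : (c : ℂ) ≠ 0 := ofReal_ne_zero.2 hc.ne'
    have h2 : Tendsto (fun y : ℝ ↦ (c : ℂ) * (F (I * ↑(y⁻¹)) / (I * ↑(y⁻¹)))⁻¹) atTop
        (𝓝 ((c : ℂ) * (c : ℂ)⁻¹)) :=
      (h1.inv₀ hc0).const_mul _
    rw [mul_inv_cancel₀ hc0] at h2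
    refine h2.congr' ?_
    filter_upwards [eventually_gt_atTop 0] with y hy
    have hy0 : (y : ℂ) ≠ 0 := ofReal_ne_zero.2 hy.ne'
    have hyi : I * ((y⁻¹ : ℝ) : ℂ) ∈ upperHalfPlaneSet := by
      show 0 < (I * ((y⁻¹ : ℝ) : ℂ)).im
      simpa using hy
    have hFp : F (I * ((y⁻¹ : ℝ) : ℂ)) ≠ 0 := by
      intro h0
      have : (0 : ℝ) < (F (I * ((y⁻¹ : ℝ) : ℂ))).im := hmaps hyi
      rw [h0] at this
      simp at this
    have hIy : -(I * (y : ℂ))⁻¹ = I * ((y⁻¹ : ℝ) : ℂ) := by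
      rw [mul_inv, inv_I, ofReal_inv]
      ring
    show (c : ℂ) * (F (I * ↑(y⁻¹)) / (I * ↑(y⁻¹)))⁻¹ = G (I * y) / (I * y)
    rw [hG]
    dsimp only
    rw [hIy, inv_div, div_div, div_eq_mul_inv (-(c : ℂ)), mul_inv, mul_inv, inv_I, ofReal_inv]
    ring
  -- Julia's lemma at `∞` for `G`, at the point `-w⁻¹`
  have hw' : 0 < (-w⁻¹).im := neg_inv_mem hw
  have key := im_le_im_of_tendsto_div hGd hGmaps hGlim hw'
  rw [hGim, neg_inv_im, inv_neg, inv_inv, neg_neg] at key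
  exact key

/-- **The angular derivatives at two boundary fixed points multiply to at least `1`** (a
consequence of Julia's lemma at `0` and at `∞`; Pommerenke (1992), §4.3): if the holomorphic
self-map `F` of `ℍₒ` has `F(iy)/(iy) → 1` as `y → +∞` and `F(iy)/(iy) → λ > 0` as `y → 0⁺`,
then `1 ≤ λ`. (At `w = i`: `1 ≤ im F(i)` and `1 ≤ λ im F(i)/|F(i)|² ≤ λ / im F(i)`.)
[cite: PommerenkeBBCM1992, §4.3 Prop. 4.13] -/
theorem one_le_of_tendsto_div {F : ℂ → ℂ} (hd : DifferentiableOn ℂ F upperHalfPlaneSet)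
    (hmaps : MapsTo F upperHalfPlaneSet upperHalfPlaneSet)
    (hinf : Tendsto (fun y : ℝ ↦ F (I * y) / (I * y)) atTop (𝓝 1)) {c : ℝ} (hc : 0 < c)
    (h0 : Tendsto (fun y : ℝ ↦ F (I * y) / (I * y)) (𝓝[>] 0) (𝓝 (c : ℂ))) : 1 ≤ c := by
  have hI : 0 < (I : ℂ).im := by simp
  have h1 := im_le_im_of_tendsto_div hd hmaps hinf hI
  have h2 := im_div_le_of_tendsto_div hd hmaps hc h0 hI
  simp only [I_im, norm_I, one_pow, div_one] at h1 h2
  have hpos : 0 < (F I).im := lt_of_lt_of_le one_pos h1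
  have hn : (F I).im ^ 2 ≤ ‖F I‖ ^ 2 := by
    have := abs_im_le_norm (F I)
    nlinarith [abs_nonneg ((F I).im), sq_abs ((F I).im)]
  have hn0 : 0 < ‖F I‖ ^ 2 := lt_of_lt_of_le (by positivity) hn
  rw [le_div_iff₀ hn0, one_mul] at h2
  -- `(im F i)² ≤ ‖F i‖² ≤ c · im F i`, so `im F i ≤ c`, and `1 ≤ im F i`
  nlinarith

end HalfPlanePick

end Literature.Probability.RandomPlanarGeometry
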